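import Summits.Ventures.CertifiedManyBodySolver.Observables.MeanFieldClassExclusionLaOverdoped
import Summits.Ventures.CertifiedManyBodySolver.Certificates.HubbardSquare_n1_upper_luc
import Literature.MathematicalPhysics.QuantumLattice.HubbardFermiSeaTangentRowsLowB
import HarnessLib

/-!
# Ventures/CertifiedManyBodySolver — Observables/MeanFieldClassExclusionLaLowU.lean

HONEST FRAMING: first certified bounds; not a superconductivity verdict; every number certified or labelled float.
A competing-order EXCLUSION removes a named class of candidate ground states; it never says which order is present;
no phase sentence follows.

Cell `hubbard-tc` (MO-S3, D-0096), seat `hubbard-tc-mod-3` (G3), `prover-hubbard-tc-mod-3-g4-0`. RE-THRESHOLD of the La₂₋ₓSrₓCuO₄ MF/BCS-class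
words at the NEW S1 box edge: §OF-RECORD v1.10 of `pub/hubbard-downfold/router/BOXES/La2CuO4-family.md` (2026-08-27T03:33Z) moved the
OBJECT-E `U/t_eff` lower edge of every La column from 7.9 to 5.9 (`[5.9, 14.7]`; #50: `[5.9, 16.7]`), below the thresholds of
`MeanFieldClassExclusionLaColumns/LaBox/LaOverdoped.lean` (`U ≥ 7 / 7 / 7.5`). For every torus limit `ω` of unit
`(rectN n L, S^z = 0)`-sector ground states of `hubbardTorusTT' L 1 t′ U`, `Re ω(n_{0↑} n_{0↓}) < (n/2)²` (no ground state is a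
non-magnetic Hartree–Fock / singlet-BCS state — Wick: `docc ≥ (n/2)²`) on `t′ ∈ [−3/10, −1/5]` and

* x = 0    (M13, hole half `n ∈ [0.99, 1]`):  EVERY `U ≥ 5.9`  (`laLow_x0_docc_lt_of`,    cond. #445 ∧ #21;  margin `+0.41`);
* x = 0.07 (M14, `n ∈ [0.91, 0.95]`):          EVERY `U ≥ 5.9`  (`laLow_x007_docc_lt_of`,  cond. #445 ∧ #21;  `+0.24`);
* x = ⅛    (M15, `n ∈ [0.855, 0.895]`):        EVERY `U ≥ 5.9`  (`laLow_x0125_docc_lt_of`, cond. #498 ∧ #445 ∧ #472; `+0.13`);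
* x = 0.15 (M16, `n ∈ [0.83, 0.87]`):          EVERY `U ≥ 5.9`  (`laLow_x015_docc_lt_of`,  cond. #498 ∧ #445; `+0.087`);
* x = 0.22 (M17, `n ∈ [0.76, 0.80]`):          EVERY `U ≥ 6`    (`laLow_x022_docc_lt_of`,  cond. #498 ∧ #445 ∧ #473; `+0.018`) — the sliver
  `[5.9, 6)` of that box stays «undetermined-MF» (at `U₁ = 5.9` the exact margin is `+0.008` before rounding losses; not filed);
* x = 0.30 (#50, `n ∈ [0.68, 0.72]`, `t′ ∈ [−1/4, −1/10]` ⊇ the box face `[−0.23, −0.13]`): EVERY `U ≥ 7` (`laLow_x030_docc_lt_of`, cond.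
  #498 ∧ #445 ∧ #472; `+0.019`; was `7.5`) — the strip `[5.9, 7)` of #50 is NOT covered by any device of record (best exact margin at
  `U₁ = 6.5`: `−0.003`): «undetermined-MF» there.

so the WHOLE new box of record carries the word for x ∈ {0, 0.07, ⅛, 0.15}, `[6, 14.7]` for x = 0.22, `[7, 16.7]` for x = 0.30.
This file (1/2) holds the devices and the x = 0 / 0.07 words; `MeanFieldClassExclusionLaLowUB.lean` (2/2, imports this file) holds x = ⅛ /
0.15 / 0.22 / 0.30 with the same devices.
Devices: the general-`U_c` docc tail `doccN_lt_of_capUc_threshold` (a cap at `U_c` — here `6` or `8` — a free floor and ONE linear margin at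
the threshold `U₁ ≤ U_c` give the word for every `U ≥ U₁`: monotone below `U_c`, Hartree–Fock Lipschitz slope `(n/2)²` above); caps = density
chords (convexity in `n`, ring-normalised: `laLow_chord_78_one / _half_78 / _half_one`) of the anchors (i) CERTIFIED #445 at `(8, 7/8, −1/4)`
transported in `t′` by the decimal kinematic law and down in `U` by monotonicity (`laLow_cap78_near/far`), or the `t′`-chord cap
`objE_conc78_cap8` (#445 ∧ #473) on `t′ ≤ −1/4`, (ii) the CERTIFIED quarter-filling cap #498 (`laLow_quarter_cap`), (iii) the half-filling caps
#472 at `U = 8` and #21 at `U = 6` (`laLow_halfFilling_cap6`; every `t′` by evenness + concavity); floors = tangent Fermi-sea rows touching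
INSIDE each band (`HubbardFermiSeaTangentRowsLowB` + part 1 + `…LscoColumns` + `…TangentRows`), read between columns by concavity
(`objE_floor_between`). The chord caps are BILINEAR in `(n, t′)`; each leaf is closed by `nlinarith` with the four McCormick products of the
leaf's rectangle (equivalent to checking the four corners), the class constant `(n/2)²` read above its tangent at the lower band edge.
Margins quoted = smallest exact corner margin per word (seat designer `hubbard-tc-mod-3/g4-replay/lowU_plan.py`, exact rationals).
WHAT THIS IS NOT: a statement about stripes, d-wave order or T_c; the saturated-FM class; tight; a phase word.

References: T. Koma, H. Tasaki, J. Stat. Phys. 76 (1994) 745, §1 [KomaTasaki1994]; V. Bach, E. H. Lieb, J. P. Solovej,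
J. Stat. Phys. 76 (1994) 3, eq. (2c.36) [BachLiebSolovej1994]; E. H. Lieb, M. Loss, Duke Math. J. 71 (1993) 337, §8 Thm 8.2
[LiebLoss1993]; R. B. Israel, Convexity in the Theory of Lattice Gases (1979), Thm I.3.4 [Israel1979]; D. Ruelle,
Statistical Mechanics (1969) §3.3 [Ruelle1969].
-/

noncomputable section

namespace Summit.Ventures.CertifiedManyBodySolver.Observables

open Literature.MathematicalPhysics.QuantumLattice
open Literature.MathematicalPhysics.QuantumLattice.ThermodynamicLimit
open Summit.Ventures.CertifiedManyBodySolver.Certificates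
open Matrix HubbardWave0 Literature.Probability.LatticeModels Filter Topology
open scoped ComplexOrder BigOperators


/-! ### §1 Devices -/

/-- **The docc tail with a cap at `U_c` and a threshold `U₁ ≤ U_c`**: a cap `e(1, t′, U_c, n) ≤ u`, a free floor `ℓ ≤ e(1, t′, 0, n)` and
ONE linear margin `u − ℓ < (n/2)²·U₁` (`0 < U₁ ≤ U_c`) give `Re ω(n_{0↑}n_{0↓}) < (n/2)²` for every GS torus limit at every `U ≥ U₁` — below
`U_c` the cap holds by monotonicity in `U`, above it grows at most with the Hartree–Fock Lipschitz slope `(n/2)²`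
(`energyDensityTT'_ge_sub_mul_sq_U`), which cancels against the class floor `ℓ + U(n/2)²` (the general-`U_c` form of `doccN_lt_of_cap8_threshold`).
[cite: KomaTasaki1994, §1] [cite: BachLiebSolovej1994, eq. (2c.36)] -/
theorem doccN_lt_of_capUc_threshold {t' U Uc n u ℓ U₁ : ℝ} (hU₁ : 0 < U₁) (hU₁c : U₁ ≤ Uc) (hU : U₁ ≤ U)
    (hn0 : 0 ≤ n) (hn2 : n < 2) (hcap : energyDensityTT' 1 t' Uc n ≤ u) (hℓ : ℓ ≤ energyDensityTT' 1 t' 0 n)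
    (hlin : u - ℓ < (n / 2) ^ 2 * U₁) :
    ∀ (ω : InfVolFermionState 2) (Ls : ℕ → ℕ) (ψ : ∀ L, Fock (Orb (FermionTorus 2 L))),
      Tendsto Ls atTop atTop →
      (∀ j, IsGroundStateInSector (hubbardTorusTT' (Ls j) 1 t' U) (rectN n (Ls j)) 0 (ψ (Ls j))) →
      (∀ j, star (ψ (Ls j)) ⬝ᵥ ψ (Ls j) = 1) → ω.IsTorusLimitOf ψ Ls →
      (ω.expect ({0} : Finset (Site 2))
        (nAt 0 (Finset.mem_singleton_self 0) 0 * nAt 0 (Finset.mem_singleton_self 0) 1)).re < (n / 2) ^ 2 := by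
  have hU0 : 0 < U := lt_of_lt_of_le hU₁ hU
  have hUc0 : 0 ≤ Uc := le_trans hU₁.le hU₁c
  have hsq : 0 ≤ (n / 2) ^ 2 := sq_nonneg _
  have hlinU : u - ℓ < (n / 2) ^ 2 * U := lt_of_lt_of_le hlin (mul_le_mul_of_nonneg_left hU hsq)
  rcases le_total U Uc with hle | hle
  · have hm := energyDensityTT'_mono_U 1 t' hn0 hn2 hU0.le hle
    exact doccN_lt_of_cap_of_floor hU0 hn0 hn2 (hm.trans hcap) hℓ hlinU
  · have hq := energyDensityTT'_ge_sub_mul_sq_U 1 t' hn0 hn2 hUc0 hle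
    have hcapU : energyDensityTT' 1 t' U n ≤ u + (U - Uc) * (n / 2) ^ 2 := by linarith
    refine doccN_lt_of_cap_of_floor hU0 hn0 hn2 hcapU hℓ ?_
    have hlinc : u - ℓ < (n / 2) ^ 2 * Uc := lt_of_lt_of_le hlin (mul_le_mul_of_nonneg_left hU₁c hsq)
    have e : u + (U - Uc) * (n / 2) ^ 2 - ℓ = (u - ℓ - (n / 2) ^ 2 * Uc) + (n / 2) ^ 2 * U := by ring
    rw [e]
    linarith

/-- **The half-filling cap at `U = 6`, every `t′`**: `e(1, s, 6, 1) ≤ −0.6271914536` (CERTIFIED #21 at `t′ = 0`, plaquette-dressed AF-HF TL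
upper; `t′`-even + concave at half filling). [cite: Israel1979, Thm. I.3.4] -/
theorem laLow_halfFilling_cap6 (h21 : cert_r21_luc_tl_upper_n1_U6) (s : ℝ) :
    energyDensityTT' 1 s 6 1 ≤ -0.6271914536 := by
  have h := m2_U6_upper_r21_of h21
  unfold M2EnergyUpperRow at h
  have h0 : energyDensityTT' 1 0 6 1 ≤ -0.6271914536 := by
    rw [energyDensityTT'_zero]
    refine h.trans ?_
    push_cast
    norm_num
  exact (energyDensityTT'_one_le_tPrime_zero 1 s (by norm_num : (0 : ℝ) ≤ 6)).trans h0

/-- **The `7/8` anchor, near side** (`−1/4 ≤ s`, `0 ≤ U_c ≤ 8`): `e(1, s, U_c, 7/8) ≤ −0.2813417849 + 1.6212·s` — CERTIFIED #445 at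
`(8, 7/8, −1/4)` transported by `1.6212·|s + 1/4|` and down in `U` by monotonicity. [cite: Israel1979, Thm. I.3.4] -/
theorem laLow_cap78_near (h445 : cert_dbt329pair_allk) {s Uc : ℝ} (hUc0 : 0 ≤ Uc) (hUc8 : Uc ≤ 8) (hs : -1 / 4 ≤ s) :
    energyDensityTT' 1 s Uc (7 / 8) ≤ -0.2813417849 + 1.6212 * s := by
  have hR := m3_tpm1o4_cap_decimal_of h445
  have h := energyDensityTT'_tPrime_transport_ge_decimal 1 (by norm_num : (0 : ℝ) ≤ 8)
    (by norm_num : (0 : ℝ) ≤ 7 / 8) (by norm_num : (7 / 8 : ℝ) < 2) s (-1 / 4)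
  rw [show (-1 / 4 : ℝ) - s = -(s + 1 / 4) by ring, abs_neg, abs_of_nonneg (by linarith : 0 ≤ s + 1 / 4)] at h
  have hm := energyDensityTT'_mono_U 1 s (n := 7 / 8) (by norm_num) (by norm_num) hUc0 hUc8
  linarith

/-- **The `7/8` anchor, far side** (`s ≤ −1/4`, `0 ≤ U_c ≤ 8`): `e(1, s, U_c, 7/8) ≤ −1.0919417849 − 1.6212·s`. [cite: Israel1979, Thm. I.3.4] -/
theorem laLow_cap78_far (h445 : cert_dbt329pair_allk) {s Uc : ℝ} (hUc0 : 0 ≤ Uc) (hUc8 : Uc ≤ 8) (hs : s ≤ -1 / 4) :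
    energyDensityTT' 1 s Uc (7 / 8) ≤ -1.0919417849 - 1.6212 * s := by
  have hR := m3_tpm1o4_cap_decimal_of h445
  have h := energyDensityTT'_tPrime_transport_ge_decimal 1 (by norm_num : (0 : ℝ) ≤ 8)
    (by norm_num : (0 : ℝ) ≤ 7 / 8) (by norm_num : (7 / 8 : ℝ) < 2) s (-1 / 4)
  rw [abs_of_nonneg (by linarith : 0 ≤ (-1 / 4 : ℝ) - s)] at h
  have hm := energyDensityTT'_mono_U 1 s (n := 7 / 8) (by norm_num) (by norm_num) hUc0 hUc8
  linarith

/-- **The quarter-filling anchor at `U_c ≤ 8`** (`s ≤ 0`): `e(1, s, U_c, 1/2) ≤ −0.9916692317 − 1.6212·s` (CERTIFIED #498, kinematic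
transport, monotonicity in `U`). [cite: Israel1979, Thm. I.3.4] -/
theorem laLow_quarter_cap (h498 : cert_r498_qfp_U8_n1o2_tp0_upper) {s Uc : ℝ} (hUc0 : 0 ≤ Uc) (hUc8 : Uc ≤ 8) (hs : s ≤ 0) :
    energyDensityTT' 1 s Uc (1 / 2) ≤ -0.9916692317 - 1.6212 * s := by
  have h := laE_quarter_cap_at (laE_quarter_cap_decimal_of h498) hs
  have hm := energyDensityTT'_mono_U 1 s (n := 1 / 2) (by norm_num) (by norm_num) hUc0 hUc8
  exact hm.trans h

/-- **Density chord `7/8 → 1`** (ring-normalised): caps `e(1, s, U, 7/8) ≤ A`, `e(1, s, U, 1) ≤ C`, `7/8 < n < 1` give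
`e(1, s, U, n) ≤ 8[(1 − n)A + (n − 7/8)C]`. [cite: Ruelle1969, §3.3] -/
theorem laLow_chord_78_one {s U n A C : ℝ} (hU : 0 ≤ U) (hA : energyDensityTT' 1 s U (7 / 8) ≤ A)
    (hC : energyDensityTT' 1 s U 1 ≤ C) (h1 : 7 / 8 < n) (h2 : n < 1) :
    energyDensityTT' 1 s U n ≤ 8 * ((1 - n) * A + (n - 7 / 8) * C) := by
  have hd := energyDensityTT'_le_density_chord 1 s hU (n₁ := 7 / 8) (n := n) (n₂ := 1)
    (by norm_num) h1 h2 (by norm_num) hA hC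
  have e1 : ((1 - n) * A + (n - 7 / 8) * C) / (1 - 7 / 8) = 8 * ((1 - n) * A + (n - 7 / 8) * C) := by ring
  rw [e1] at hd
  exact hd

/-- **Density chord `1/2 → 7/8`**: caps `e(1, s, U, 1/2) ≤ H`, `e(1, s, U, 7/8) ≤ A`, `1/2 < n < 7/8` give
`e(1, s, U, n) ≤ (8/3)[(7/8 − n)H + (n − 1/2)A]`. [cite: Ruelle1969, §3.3] -/
theorem laLow_chord_half_78 {s U n H A : ℝ} (hU : 0 ≤ U) (hH : energyDensityTT' 1 s U (1 / 2) ≤ H)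
    (hA : energyDensityTT' 1 s U (7 / 8) ≤ A) (h1 : 1 / 2 < n) (h2 : n < 7 / 8) :
    energyDensityTT' 1 s U n ≤ 8 / 3 * ((7 / 8 - n) * H + (n - 1 / 2) * A) := by
  have hd := energyDensityTT'_le_density_chord 1 s hU (n₁ := 1 / 2) (n := n) (n₂ := 7 / 8)
    (by norm_num) h1 h2 (by norm_num) hH hA
  have e1 : ((7 / 8 - n) * H + (n - 1 / 2) * A) / (7 / 8 - 1 / 2) = 8 / 3 * ((7 / 8 - n) * H + (n - 1 / 2) * A) := by ring
  rw [e1] at hd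
  exact hd

/-- **Density chord `1/2 → 1`**: caps `e(1, s, U, 1/2) ≤ H`, `e(1, s, U, 1) ≤ C`, `1/2 < n < 1` give
`e(1, s, U, n) ≤ 2[(1 − n)H + (n − 1/2)C]`. [cite: Ruelle1969, §3.3] -/
theorem laLow_chord_half_one {s U n H C : ℝ} (hU : 0 ≤ U) (hH : energyDensityTT' 1 s U (1 / 2) ≤ H)
    (hC : energyDensityTT' 1 s U 1 ≤ C) (h1 : 1 / 2 < n) (h2 : n < 1) :
    energyDensityTT' 1 s U n ≤ 2 * ((1 - n) * H + (n - 1 / 2) * C) := by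
  have hd := energyDensityTT'_le_density_chord 1 s hU (n₁ := 1 / 2) (n := n) (n₂ := 1)
    (by norm_num) h1 h2 (by norm_num) hH hC
  have e1 : ((1 - n) * H + (n - 1 / 2) * C) / (1 - 1 / 2) = 2 * ((1 - n) * H + (n - 1 / 2) * C) := by ring
  rw [e1] at hd
  exact hd


/-! ### §2 The words at the new box edge -/
/-- **La₂CuO₄ (VSET M13), OBJECT E `[5.9, 14.7] × [−0.30, −0.20]`, hole half `n ∈ [0.99, 1]` — MF/BCS class excluded on the WHOLE new box:** for `t′ ∈ [−3/10, −1/5]`, EVERY `U ≥ 5.9`, `n ∈ [99/100, 1]`, every GS torus limit has `Re ω(n_{0↑}n_{0↓}) < (n/2)²`. Cap at `U_c = 6` = chord `7/8 → 1` of the transported #445 anchor and the #21 half-filling cap; floor = tangent rows at `n₀ = 1`; smallest margin `+0.41`. [cite: KomaTasaki1994, §1] [cite: BachLiebSolovej1994, eq. (2c.36)] [cite: LiebLoss1993, §8, Theorem 8.2] -/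
theorem laLow_x0_docc_lt_of (h445 : cert_dbt329pair_allk) (h21 : cert_r21_luc_tl_upper_n1_U6)
    {t' U n : ℝ} (ht1 : -3 / 10 ≤ t') (ht2 : t' ≤ -1 / 5) (hU : 59 / 10 ≤ U)
    (hn1 : 99 / 100 ≤ n) (hn2 : n ≤ 1) :
    ∀ (ω : InfVolFermionState 2) (Ls : ℕ → ℕ) (ψ : ∀ L, Fock (Orb (FermionTorus 2 L))),
      Tendsto Ls atTop atTop →
      (∀ j, IsGroundStateInSector (hubbardTorusTT' (Ls j) 1 t' U) (rectN n (Ls j)) 0 (ψ (Ls j))) →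
      (∀ j, star (ψ (Ls j)) ⬝ᵥ ψ (Ls j) = 1) → ω.IsTorusLimitOf ψ Ls →
      (ω.expect ({0} : Finset (Site 2))
        (nAt 0 (Finset.mem_singleton_self 0) 0 * nAt 0 (Finset.mem_singleton_self 0) 1)).re < (n / 2) ^ 2 := by
  have hn0 : (0 : ℝ) ≤ n := by linarith
  have hn2' : n < 2 := by linarith
  -- the class constant `(n/2)²` above its tangent at the lower band edge, scaled by the threshold
  have hsq : (-9801 / 40000 : ℝ) + 99 / 200 * n ≤ (n / 2) ^ 2 := by nlinarith [sq_nonneg (n - 99 / 100)]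
  have hsqU : ((-9801 / 40000 : ℝ) + 99 / 200 * n) * (59 / 10) ≤ (n / 2) ^ 2 * (59 / 10) :=
    mul_le_mul_of_nonneg_right hsq (by norm_num)
  have h6 : (0 : ℝ) ≤ 6 := by norm_num
  have hC := laLow_halfFilling_cap6 h21 t'
  have ra := fermiSeaTangentRow_tPrime_neg_three_div_ten_at_one (U := 0) le_rfl hn0 hn2'
  have rb := fermiSeaTangentRow_tPrime_neg_one_div_four_at_one (U := 0) le_rfl hn0 hn2'
  have rc := fermiSeaTangentRow_tPrime_neg_one_div_five_at_one (U := 0) le_rfl hn0 hn2'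
  rcases eq_or_lt_of_le hn2 with heq | hlt
  · -- `n = 1`: the cap is the half-filling cap itself
    subst heq
    have hcap := hC
    rcases le_or_gt t' (-1 / 4) with hp | hp
    · have hfl := objE_floor_between hn0 hn2' (by norm_num : (-3 / 10 : ℝ) ≤ -1 / 4) ra rb ht1 hp
      exact doccN_lt_of_capUc_threshold (U₁ := 59 / 10) (Uc := 6) (by norm_num) (by norm_num) hU hn0 hn2' hcap hfl
        (sub_min_lt_of (by linarith) (by linarith))
    · have hfl := objE_floor_between hn0 hn2' (by norm_num : (-1 / 4 : ℝ) ≤ -1 / 5) rb rc hp.le ht2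
      exact doccN_lt_of_capUc_threshold (U₁ := 59 / 10) (Uc := 6) (by norm_num) (by norm_num) hU hn0 hn2' hcap hfl
        (sub_min_lt_of (by linarith) (by linarith))
  · rcases le_or_gt t' (-1 / 4) with hp | hp
    · -- piece `[-3/10, -1/4]`, chord `7/8 → 1` on the far-side anchor
      have hA := laLow_cap78_far h445 h6 (by norm_num) hp
      have hcap := laLow_chord_78_one (n := n) h6 hA hC (by linarith) hlt
      have hfl := objE_floor_between hn0 hn2' (by norm_num : (-3 / 10 : ℝ) ≤ -1 / 4) ra rb ht1 hp
      exact doccN_lt_of_capUc_threshold (U₁ := 59 / 10) (Uc := 6) (by norm_num) (by norm_num) hU hn0 hn2' hcap hfl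
        (sub_min_lt_of
          (by nlinarith [mul_nonneg (sub_nonneg.2 hn1) (sub_nonneg.2 ht1), mul_nonneg (sub_nonneg.2 hn1) (sub_nonneg.2 hp),
          mul_nonneg (sub_nonneg.2 hn2) (sub_nonneg.2 ht1), mul_nonneg (sub_nonneg.2 hn2) (sub_nonneg.2 hp), hsqU])
          (by nlinarith [mul_nonneg (sub_nonneg.2 hn1) (sub_nonneg.2 ht1), mul_nonneg (sub_nonneg.2 hn1) (sub_nonneg.2 hp),
          mul_nonneg (sub_nonneg.2 hn2) (sub_nonneg.2 ht1), mul_nonneg (sub_nonneg.2 hn2) (sub_nonneg.2 hp), hsqU]))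
    · -- piece `(-1/4, -1/5]`, near-side anchor
      have hA := laLow_cap78_near h445 h6 (by norm_num) hp.le
      have hcap := laLow_chord_78_one (n := n) h6 hA hC (by linarith) hlt
      have hfl := objE_floor_between hn0 hn2' (by norm_num : (-1 / 4 : ℝ) ≤ -1 / 5) rb rc hp.le ht2
      exact doccN_lt_of_capUc_threshold (U₁ := 59 / 10) (Uc := 6) (by norm_num) (by norm_num) hU hn0 hn2' hcap hfl
        (sub_min_lt_of
          (by nlinarith [mul_nonneg (sub_nonneg.2 hn1) (sub_nonneg.2 (le_of_lt hp)), mul_nonneg (sub_nonneg.2 hn1) (sub_nonneg.2 ht2),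
          mul_nonneg (sub_nonneg.2 hn2) (sub_nonneg.2 (le_of_lt hp)), mul_nonneg (sub_nonneg.2 hn2) (sub_nonneg.2 ht2), hsqU])
          (by nlinarith [mul_nonneg (sub_nonneg.2 hn1) (sub_nonneg.2 (le_of_lt hp)), mul_nonneg (sub_nonneg.2 hn1) (sub_nonneg.2 ht2),
          mul_nonneg (sub_nonneg.2 hn2) (sub_nonneg.2 (le_of_lt hp)), mul_nonneg (sub_nonneg.2 hn2) (sub_nonneg.2 ht2), hsqU]))

/-- **La₁.₉₃Sr₀.₀₇CuO₄ (M14), OBJECT E, `n ∈ [0.91, 0.95]` — MF/BCS class excluded on the WHOLE new box:** `t′ ∈ [−3/10, −1/5]`, EVERY `U ≥ 5.9`. Cap at `U_c = 6` = chord `7/8 → 1` (#445 transported, #21); floor = tangent rows at `n₀ = 93/100`; smallest margin `+0.24`. [cite: KomaTasaki1994, §1] [cite: BachLiebSolovej1994, eq. (2c.36)] [cite: LiebLoss1993, §8, Theorem 8.2] -/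
theorem laLow_x007_docc_lt_of (h445 : cert_dbt329pair_allk) (h21 : cert_r21_luc_tl_upper_n1_U6)
    {t' U n : ℝ} (ht1 : -3 / 10 ≤ t') (ht2 : t' ≤ -1 / 5) (hU : 59 / 10 ≤ U)
    (hn1 : 91 / 100 ≤ n) (hn2 : n ≤ 19 / 20) :
    ∀ (ω : InfVolFermionState 2) (Ls : ℕ → ℕ) (ψ : ∀ L, Fock (Orb (FermionTorus 2 L))),
      Tendsto Ls atTop atTop →
      (∀ j, IsGroundStateInSector (hubbardTorusTT' (Ls j) 1 t' U) (rectN n (Ls j)) 0 (ψ (Ls j))) →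
      (∀ j, star (ψ (Ls j)) ⬝ᵥ ψ (Ls j) = 1) → ω.IsTorusLimitOf ψ Ls →
      (ω.expect ({0} : Finset (Site 2))
        (nAt 0 (Finset.mem_singleton_self 0) 0 * nAt 0 (Finset.mem_singleton_self 0) 1)).re < (n / 2) ^ 2 := by
  have hn0 : (0 : ℝ) ≤ n := by linarith
  have hn2' : n < 2 := by linarith
  -- the class constant `(n/2)²` above its tangent at the lower band edge, scaled by the threshold
  have hsq : (-8281 / 40000 : ℝ) + 91 / 200 * n ≤ (n / 2) ^ 2 := by nlinarith [sq_nonneg (n - 91 / 100)]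
  have hsqU : ((-8281 / 40000 : ℝ) + 91 / 200 * n) * (59 / 10) ≤ (n / 2) ^ 2 * (59 / 10) :=
    mul_le_mul_of_nonneg_right hsq (by norm_num)
  have h6 : (0 : ℝ) ≤ 6 := by norm_num
  have hC := laLow_halfFilling_cap6 h21 t'
  have ra := fermiSeaTangentRow_tPrime_neg_three_div_ten_at_ninetythree_div_hundred (U := 0) le_rfl hn0 hn2'
  have rb := fermiSeaTangentRow_tPrime_neg_one_div_four_at_ninetythree_div_hundred (U := 0) le_rfl hn0 hn2'
  have rc := fermiSeaTangentRow_tPrime_neg_one_div_five_at_ninetythree_div_hundred (U := 0) le_rfl hn0 hn2'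
  rcases le_or_gt t' (-1 / 4) with hp | hp
  · -- piece `[-3/10, -1/4]`
    have hA := laLow_cap78_far h445 h6 (by norm_num) hp
    have hcap := laLow_chord_78_one (n := n) h6 hA hC (by linarith) (by linarith)
    have hfl := objE_floor_between hn0 hn2' (by norm_num : (-3 / 10 : ℝ) ≤ -1 / 4) ra rb ht1 hp
    exact doccN_lt_of_capUc_threshold (U₁ := 59 / 10) (Uc := 6) (by norm_num) (by norm_num) hU hn0 hn2' hcap hfl
      (sub_min_lt_of
        (by nlinarith [mul_nonneg (sub_nonneg.2 hn1) (sub_nonneg.2 ht1), mul_nonneg (sub_nonneg.2 hn1) (sub_nonneg.2 hp),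
          mul_nonneg (sub_nonneg.2 hn2) (sub_nonneg.2 ht1), mul_nonneg (sub_nonneg.2 hn2) (sub_nonneg.2 hp), hsqU])
        (by nlinarith [mul_nonneg (sub_nonneg.2 hn1) (sub_nonneg.2 ht1), mul_nonneg (sub_nonneg.2 hn1) (sub_nonneg.2 hp),
          mul_nonneg (sub_nonneg.2 hn2) (sub_nonneg.2 ht1), mul_nonneg (sub_nonneg.2 hn2) (sub_nonneg.2 hp), hsqU]))
  · -- piece `(-1/4, -1/5]`
    have hA := laLow_cap78_near h445 h6 (by norm_num) hp.le
    have hcap := laLow_chord_78_one (n := n) h6 hA hC (by linarith) (by linarith)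
    have hfl := objE_floor_between hn0 hn2' (by norm_num : (-1 / 4 : ℝ) ≤ -1 / 5) rb rc hp.le ht2
    exact doccN_lt_of_capUc_threshold (U₁ := 59 / 10) (Uc := 6) (by norm_num) (by norm_num) hU hn0 hn2' hcap hfl
      (sub_min_lt_of
        (by nlinarith [mul_nonneg (sub_nonneg.2 hn1) (sub_nonneg.2 (le_of_lt hp)), mul_nonneg (sub_nonneg.2 hn1) (sub_nonneg.2 ht2),
          mul_nonneg (sub_nonneg.2 hn2) (sub_nonneg.2 (le_of_lt hp)), mul_nonneg (sub_nonneg.2 hn2) (sub_nonneg.2 ht2), hsqU])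
        (by nlinarith [mul_nonneg (sub_nonneg.2 hn1) (sub_nonneg.2 (le_of_lt hp)), mul_nonneg (sub_nonneg.2 hn1) (sub_nonneg.2 ht2),
          mul_nonneg (sub_nonneg.2 hn2) (sub_nonneg.2 (le_of_lt hp)), mul_nonneg (sub_nonneg.2 hn2) (sub_nonneg.2 ht2), hsqU]))

/-! ### §3 The VSET-v2 child columns x = 0.05 / 0.03 (appended 2026-08-27 by g4; same devices) -/

/-- **La₁.₉₅Sr₀.₀₅CuO₄ (VSET-v2 M53, new column of the La box; object E `[5.9, 14.7] × [−0.30, −0.20] × [0.93, 0.97]`) — MF/BCS class excluded on the WHOLE box** (appended 2026-08-27 by g4): `t′ ∈ [−3/10, −1/5]`, EVERY `U ≥ 5.9`, `n ∈ [93/100, 97/100]`. Cap at `U_c = 6` = chord `7/8 → 1` (#445 transported, #21); floor = tangent rows at `n₀ = 93/100`; smallest margin `+0.28`. [cite: KomaTasaki1994, §1] [cite: BachLiebSolovej1994, eq. (2c.36)] [cite: LiebLoss1993, §8, Theorem 8.2] -/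
theorem laLow_x005_docc_lt_of (h445 : cert_dbt329pair_allk) (h21 : cert_r21_luc_tl_upper_n1_U6)
    {t' U n : ℝ} (ht1 : -3 / 10 ≤ t') (ht2 : t' ≤ -1 / 5) (hU : 59 / 10 ≤ U)
    (hn1 : 93 / 100 ≤ n) (hn2 : n ≤ 97 / 100) :
    ∀ (ω : InfVolFermionState 2) (Ls : ℕ → ℕ) (ψ : ∀ L, Fock (Orb (FermionTorus 2 L))),
      Tendsto Ls atTop atTop →
      (∀ j, IsGroundStateInSector (hubbardTorusTT' (Ls j) 1 t' U) (rectN n (Ls j)) 0 (ψ (Ls j))) →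
      (∀ j, star (ψ (Ls j)) ⬝ᵥ ψ (Ls j) = 1) → ω.IsTorusLimitOf ψ Ls →
      (ω.expect ({0} : Finset (Site 2))
        (nAt 0 (Finset.mem_singleton_self 0) 0 * nAt 0 (Finset.mem_singleton_self 0) 1)).re < (n / 2) ^ 2 := by
  have hn0 : (0 : ℝ) ≤ n := by linarith
  have hn2' : n < 2 := by linarith
  -- the class constant `(n/2)²` above its tangent at the lower band edge, scaled by the threshold
  have hsq : (-8649 / 40000 : ℝ) + 93 / 200 * n ≤ (n / 2) ^ 2 := by nlinarith [sq_nonneg (n - 93 / 100)]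
  have hsqU : ((-8649 / 40000 : ℝ) + 93 / 200 * n) * (59 / 10) ≤ (n / 2) ^ 2 * (59 / 10) :=
    mul_le_mul_of_nonneg_right hsq (by norm_num)
  have h6 : (0 : ℝ) ≤ 6 := by norm_num
  have hC := laLow_halfFilling_cap6 h21 t'
  have ra := fermiSeaTangentRow_tPrime_neg_three_div_ten_at_ninetythree_div_hundred (U := 0) le_rfl hn0 hn2'
  have rb := fermiSeaTangentRow_tPrime_neg_one_div_four_at_ninetythree_div_hundred (U := 0) le_rfl hn0 hn2'
  have rc := fermiSeaTangentRow_tPrime_neg_one_div_five_at_ninetythree_div_hundred (U := 0) le_rfl hn0 hn2'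
  rcases le_or_gt t' (-1 / 4) with hp | hp
  · -- piece `[-3/10, -1/4]`
    have hA := laLow_cap78_far h445 h6 (by norm_num) hp
    have hcap := laLow_chord_78_one (n := n) h6 hA hC (by linarith) (by linarith)
    have hfl := objE_floor_between hn0 hn2' (by norm_num : (-3 / 10 : ℝ) ≤ -1 / 4) ra rb ht1 hp
    exact doccN_lt_of_capUc_threshold (U₁ := 59 / 10) (Uc := 6) (by norm_num) (by norm_num) hU hn0 hn2' hcap hfl
      (sub_min_lt_of
        (by nlinarith [mul_nonneg (sub_nonneg.2 hn1) (sub_nonneg.2 ht1), mul_nonneg (sub_nonneg.2 hn1) (sub_nonneg.2 hp),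
          mul_nonneg (sub_nonneg.2 hn2) (sub_nonneg.2 ht1), mul_nonneg (sub_nonneg.2 hn2) (sub_nonneg.2 hp), hsqU])
        (by nlinarith [mul_nonneg (sub_nonneg.2 hn1) (sub_nonneg.2 ht1), mul_nonneg (sub_nonneg.2 hn1) (sub_nonneg.2 hp),
          mul_nonneg (sub_nonneg.2 hn2) (sub_nonneg.2 ht1), mul_nonneg (sub_nonneg.2 hn2) (sub_nonneg.2 hp), hsqU]))
  · -- piece `(-1/4, -1/5]`
    have hA := laLow_cap78_near h445 h6 (by norm_num) hp.le
    have hcap := laLow_chord_78_one (n := n) h6 hA hC (by linarith) (by linarith)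
    have hfl := objE_floor_between hn0 hn2' (by norm_num : (-1 / 4 : ℝ) ≤ -1 / 5) rb rc hp.le ht2
    exact doccN_lt_of_capUc_threshold (U₁ := 59 / 10) (Uc := 6) (by norm_num) (by norm_num) hU hn0 hn2' hcap hfl
      (sub_min_lt_of
        (by nlinarith [mul_nonneg (sub_nonneg.2 hn1) (sub_nonneg.2 (le_of_lt hp)), mul_nonneg (sub_nonneg.2 hn1) (sub_nonneg.2 ht2),
          mul_nonneg (sub_nonneg.2 hn2) (sub_nonneg.2 (le_of_lt hp)), mul_nonneg (sub_nonneg.2 hn2) (sub_nonneg.2 ht2), hsqU])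
        (by nlinarith [mul_nonneg (sub_nonneg.2 hn1) (sub_nonneg.2 (le_of_lt hp)), mul_nonneg (sub_nonneg.2 hn1) (sub_nonneg.2 ht2),
          mul_nonneg (sub_nonneg.2 hn2) (sub_nonneg.2 (le_of_lt hp)), mul_nonneg (sub_nonneg.2 hn2) (sub_nonneg.2 ht2), hsqU]))

/-- **La₁.₉₇Sr₀.₀₃CuO₄ (VSET-v2 M54; object E `[5.9, 14.7] × [−0.30, −0.20] × [0.95, 0.99]`) — MF/BCS class excluded on the WHOLE box** (appended 2026-08-27 by g4): `t′ ∈ [−3/10, −1/5]`, EVERY `U ≥ 5.9`, `n ∈ [19/20, 99/100]`. Cap at `U_c = 6` = chord `7/8 → 1` (#445 transported, #21); floor = tangent rows at `n₀ = 1`; smallest margin `+0.32`. [cite: KomaTasaki1994, §1] [cite: BachLiebSolovej1994, eq. (2c.36)] [cite: LiebLoss1993, §8, Theorem 8.2] -/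
theorem laLow_x003_docc_lt_of (h445 : cert_dbt329pair_allk) (h21 : cert_r21_luc_tl_upper_n1_U6)
    {t' U n : ℝ} (ht1 : -3 / 10 ≤ t') (ht2 : t' ≤ -1 / 5) (hU : 59 / 10 ≤ U)
    (hn1 : 19 / 20 ≤ n) (hn2 : n ≤ 99 / 100) :
    ∀ (ω : InfVolFermionState 2) (Ls : ℕ → ℕ) (ψ : ∀ L, Fock (Orb (FermionTorus 2 L))),
      Tendsto Ls atTop atTop →
      (∀ j, IsGroundStateInSector (hubbardTorusTT' (Ls j) 1 t' U) (rectN n (Ls j)) 0 (ψ (Ls j))) →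
      (∀ j, star (ψ (Ls j)) ⬝ᵥ ψ (Ls j) = 1) → ω.IsTorusLimitOf ψ Ls →
      (ω.expect ({0} : Finset (Site 2))
        (nAt 0 (Finset.mem_singleton_self 0) 0 * nAt 0 (Finset.mem_singleton_self 0) 1)).re < (n / 2) ^ 2 := by
  have hn0 : (0 : ℝ) ≤ n := by linarith
  have hn2' : n < 2 := by linarith
  -- the class constant `(n/2)²` above its tangent at the lower band edge, scaled by the threshold
  have hsq : (-361 / 1600 : ℝ) + 19 / 40 * n ≤ (n / 2) ^ 2 := by nlinarith [sq_nonneg (n - 19 / 20)]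
  have hsqU : ((-361 / 1600 : ℝ) + 19 / 40 * n) * (59 / 10) ≤ (n / 2) ^ 2 * (59 / 10) :=
    mul_le_mul_of_nonneg_right hsq (by norm_num)
  have h6 : (0 : ℝ) ≤ 6 := by norm_num
  have hC := laLow_halfFilling_cap6 h21 t'
  have ra := fermiSeaTangentRow_tPrime_neg_three_div_ten_at_one (U := 0) le_rfl hn0 hn2'
  have rb := fermiSeaTangentRow_tPrime_neg_one_div_four_at_one (U := 0) le_rfl hn0 hn2'
  have rc := fermiSeaTangentRow_tPrime_neg_one_div_five_at_one (U := 0) le_rfl hn0 hn2'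
  rcases le_or_gt t' (-1 / 4) with hp | hp
  · -- piece `[-3/10, -1/4]`
    have hA := laLow_cap78_far h445 h6 (by norm_num) hp
    have hcap := laLow_chord_78_one (n := n) h6 hA hC (by linarith) (by linarith)
    have hfl := objE_floor_between hn0 hn2' (by norm_num : (-3 / 10 : ℝ) ≤ -1 / 4) ra rb ht1 hp
    exact doccN_lt_of_capUc_threshold (U₁ := 59 / 10) (Uc := 6) (by norm_num) (by norm_num) hU hn0 hn2' hcap hfl
      (sub_min_lt_of
        (by nlinarith [mul_nonneg (sub_nonneg.2 hn1) (sub_nonneg.2 ht1), mul_nonneg (sub_nonneg.2 hn1) (sub_nonneg.2 hp),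
          mul_nonneg (sub_nonneg.2 hn2) (sub_nonneg.2 ht1), mul_nonneg (sub_nonneg.2 hn2) (sub_nonneg.2 hp), hsqU])
        (by nlinarith [mul_nonneg (sub_nonneg.2 hn1) (sub_nonneg.2 ht1), mul_nonneg (sub_nonneg.2 hn1) (sub_nonneg.2 hp),
          mul_nonneg (sub_nonneg.2 hn2) (sub_nonneg.2 ht1), mul_nonneg (sub_nonneg.2 hn2) (sub_nonneg.2 hp), hsqU]))
  · -- piece `(-1/4, -1/5]`
    have hA := laLow_cap78_near h445 h6 (by norm_num) hp.le
    have hcap := laLow_chord_78_one (n := n) h6 hA hC (by linarith) (by linarith)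
    have hfl := objE_floor_between hn0 hn2' (by norm_num : (-1 / 4 : ℝ) ≤ -1 / 5) rb rc hp.le ht2
    exact doccN_lt_of_capUc_threshold (U₁ := 59 / 10) (Uc := 6) (by norm_num) (by norm_num) hU hn0 hn2' hcap hfl
      (sub_min_lt_of
        (by nlinarith [mul_nonneg (sub_nonneg.2 hn1) (sub_nonneg.2 (le_of_lt hp)), mul_nonneg (sub_nonneg.2 hn1) (sub_nonneg.2 ht2),
          mul_nonneg (sub_nonneg.2 hn2) (sub_nonneg.2 (le_of_lt hp)), mul_nonneg (sub_nonneg.2 hn2) (sub_nonneg.2 ht2), hsqU])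
        (by nlinarith [mul_nonneg (sub_nonneg.2 hn1) (sub_nonneg.2 (le_of_lt hp)), mul_nonneg (sub_nonneg.2 hn1) (sub_nonneg.2 ht2),
          mul_nonneg (sub_nonneg.2 hn2) (sub_nonneg.2 (le_of_lt hp)), mul_nonneg (sub_nonneg.2 hn2) (sub_nonneg.2 ht2), hsqU]))

end Summit.Ventures.CertifiedManyBodySolver.Observables

end
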